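import Summits.QuantumFields.YangMills.Theorems.Instrument.BesselCapObjectsKZL2rpLIM
import HarnessLib

/-!
# YM instrument cell — `SU(2)`, `D = 4`: the UNCAPPED class-LIMIT row objects of the R0 kz-L2-rp «LIMIT (| cap)» files, typed at
# infinite-volume limit points in the files' own variables (`hd/R·/convex`, `hk/R3/H1link`, `hankel-site`, `hankel-link` blocks)

Cell `ym-instrument` (HUMAN RULING D-0084 (2); director-ym R138; HOME `run/shared/lean/pub/ym-instrument/`), crew (a),
Lean typist seat `ym-instrument-boot-lean-1` (gen 3). Companion of `Instrument/BesselCapObjectsKZL2rpLIM` (the CAP objects): the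
remaining LIMIT-only objects declared by the three R0 «LIMIT | cap» problem files of `certs/a/limit/index.jsonl`
(`SU2-D4-b9o5-kzL2rphkhdcap-LIM-lin-chi22-{c3o2,c2}-lower`, `SU2-D4-b11o5-kzL2rphkhdcap-LIM-lin-chi22-c3o2-lower`; the same
objects occur in the uncapped R0 `kzL2rphkhd-LIM` files of the `9/5`, `2`, `11/5` rows), written in the class-LIMIT variables
`yLim μ v = ∫ W_0(label v) dμ` through the dictionary `yLim μ {0,1,2,5,27,13} = g₁(0), g₁(1), g₁(2), g₁(3), g₁(4), g₂(2)` and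
`yLim μ 2 = g₂(1)`, `yLim μ 5 = g₃(1)`; together with the uncapped files' `hd/R·/mono` rows and `hd/R1/D0`, `hd/R1/D1` difference-Hankel
blocks (λ = 1), so that EVERY non-Class-A object of EVERY R0 kz-L2-rp class-LIMIT file of record (`kzL2rphkhd(sbox)-LIM` at `9/5`, `2`;
`kzL2rphkhdcap-LIM` at `9/5`, `11/5`) is a named theorem about `yLim`. Ladder consequence: provenance of the R0 class-LIMIT rows of TABLE-A1 (IR
`stmt-QuantumFields-19354`); no number, grade or verdict moves; the rows REMAIN class LIMIT and certified-conditional on their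
limit-point reading (the dual-certificate replay is NOT typed here).

HONEST FRAMING (page 1 of every file of this cell): WHAT IS CERTIFIED HERE, AT WHICH `(G, D, L, β)`: `G = SU(2)` (fundamental,
standard Wilson action, tree coupling `β/2`), `D = 4`, class LIMIT = infinite-volume limit points `μ` of the torus Wilson states
along strictly increasing sequences of EVEN tori, every `β_std ≥ 0` (the objects below do not depend on the cap): (i) `hd/R1/convex
t=0,1,2`: `2y₁ ≤ y₀ + y₂`, `2y₂ ≤ y₁ + y₅`, `2y₅ ≤ y₂ + y₂₇`; `hd/R2/convex t=0`: `2y₂ ≤ y₀ + y₁₃`; (ii) `hk/R3/H1link{0}`: `0 ≤ y₅`;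
(iii) the Hankel blocks `hankel-site/R1/S0-2` (`[g₁(a+b)]_{a,b<3}` on `y₀,y₁,y₂,y₅,y₂₇`), `hankel-site/R2/S0-1` (`y₀, y₂, y₁₃`),
`hankel-link/R1/S0-1` (`y₁, y₂, y₅`), each for all real coefficients; (iv) the uncapped files' `hd/R1/mono t=1,2,3` (`y₂ ≤ y₁`, `y₅ ≤ y₂`,
`y₂₇ ≤ y₅`), `hd/R2/mono t=1` (`y₁₃ ≤ y₂`) and difference-Hankel blocks `hd/R1/D0{0..1}` (entries `y₀−y₁, y₁−y₂, y₂−y₅`), `hd/R1/D1{0..1}`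
(`y₁−y₂, y₂−y₅, y₅−y₂₇`) — tree `Hankel.wilsonLoop_integral_limit_hankelDiff_site/_link` (Lemma HD). Inputs: the tree's `WilsonLoopLimit.antitone_wilsonLoop_integral_limit`,
`wilsonLoop_integral_limit_hankel`, `wilsonLoop_integral_limit_gram_even/_odd` (torus RP Gram inequalities and minors passed to the
limit — `WilsonLoopLimitMonotone`; LIMIT POINTS ONLY, false on a fixed torus) and the dictionary of `BesselCapObjectsKZL2rpLIM`.
NOT a finite-torus statement; not an area law, string tension, mass gap or continuum statement; nothing summit-bearing.
-/

noncomputable section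

namespace Summit.QuantumFields.YangMills.Theorems.Instrument

open MeasureTheory Filter Topology Finset
open Summit.QuantumFields.GaugeBoot
open Summit.QuantumFields.GaugeBoot.WilsonLoopLimit
open Literature.MathematicalPhysics.QuantumFieldTheory
open Literature.MathematicalPhysics.QuantumLattice (LGConfig IsInfiniteVolumeLimitAlong wilsonLoopObs rectWalk
  normalisedCharacter)

variable {β : ℝ} {Lk : ℕ → ℕ} {μ : Measure (LGConfig 4 (SU 2))}

/-- `yLim μ 5 = g₃(1)` (`W̄(3×1) = W̄(1×3)` at limit points). [folklore] -/
theorem yLim_five' (hμ : IsInfiniteVolumeLimitAlong (suRep 2) (β / (2 : ℕ)) Lk μ) : yLim μ 5 = gLim μ 1 3 1 := by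
  rw [yLim_five hμ, gLim_eq, gLim_eq]
  exact wilsonLoop_integral_limit_comm hμ (show (1 : Fin 4) ≠ 0 by decide) 3 1

/-- A double sum over `range 3`, written out. [folklore] -/
theorem sum_range_three_three (F : ℕ → ℕ → ℝ) :
    ∑ a ∈ range 3, ∑ b ∈ range 3, F a b =
      F 0 0 + F 0 1 + F 0 2 + (F 1 0 + F 1 1 + F 1 2) + (F 2 0 + F 2 1 + F 2 2) := by
  simp only [sum_range_succ, sum_range_zero, zero_add]

section Objects

variable (hβ : 0 ≤ β) (hmono : StrictMono Lk) (heven : ∀ k, Even (Lk k + 1))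
  (hμ : IsInfiniteVolumeLimitAlong (suRep 2) (β / (2 : ℕ)) Lk μ)
include hβ hmono heven hμ

/-- `hd/R1/convex t=0`: `2 f₁(1) − f₁(0) − f₁(2) ≤ 0`, i.e. `2 y₁ ≤ y₀ + y₂` (LIMIT POINTS along even tori; any `β_std ≥ 0`). [folklore] -/
theorem limObj_convex_R1_t0 : 2 * yLim μ 1 ≤ yLim μ 0 + yLim μ 2 := by
  rw [yLim_one hμ, yLim_zero_eq_gLim hμ, yLim_two hμ]
  exact (antitone_wilsonLoop_integral_limit hβ hmono heven hμ (show (1 : Fin 4) ≠ 0 by decide) 1).2 0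

/-- `hd/R1/convex t=1`: `2 y₂ ≤ y₁ + y₅`. [folklore] -/
theorem limObj_convex_R1_t1 : 2 * yLim μ 2 ≤ yLim μ 1 + yLim μ 5 := by
  rw [yLim_one hμ, yLim_two hμ, yLim_five hμ]
  exact (antitone_wilsonLoop_integral_limit hβ hmono heven hμ (show (1 : Fin 4) ≠ 0 by decide) 1).2 1

/-- `hd/R1/convex t=2`: `2 y₅ ≤ y₂ + y₂₇`. [folklore] -/
theorem limObj_convex_R1_t2 : 2 * yLim μ 5 ≤ yLim μ 2 + yLim μ 27 := by
  rw [yLim_two hμ, yLim_five hμ, yLim_twentyseven hμ]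
  exact (antitone_wilsonLoop_integral_limit hβ hmono heven hμ (show (1 : Fin 4) ≠ 0 by decide) 1).2 2

/-- `hd/R2/convex t=0`: `2 f₂(1) − f₂(0) − f₂(2) ≤ 0`, i.e. `2 y₂ ≤ y₀ + y₁₃`. [folklore] -/
theorem limObj_convex_R2_t0 : 2 * yLim μ 2 ≤ yLim μ 0 + yLim μ 13 := by
  rw [yLim_two' hμ, yLim_thirteen hμ, yLim_zero hμ, gLim_eq, gLim_eq,
    ← wilsonLoop_integral_limit_height_zero (by norm_num) hμ 1 2]
  exact (antitone_wilsonLoop_integral_limit hβ hmono heven hμ (show (1 : Fin 4) ≠ 0 by decide) 2).2 0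

/-- `hk/R3/H1link{0}`: `−f₃(1) ≤ 0`, i.e. `0 ≤ y₅`. [folklore] -/
theorem limObj_nonneg_y5 : 0 ≤ yLim μ 5 := by
  rw [yLim_five' hμ]
  exact (wilsonLoop_integral_limit_hankel hβ hmono heven hμ (show (1 : Fin 4) ≠ 0 by decide) 3).1 1

omit hβ in
/-- `hankel-site/R2/S0-1`: the block `[[y₀, y₂], [y₂, y₁₃]]` (= `[g₂(a+b)]_{a,b<2}`) is positive semidefinite (any real `β`).
[folklore] -/
theorem limObj_hankelSite_R2 (c₀ c₁ : ℝ) :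
    0 ≤ c₀ * c₀ * yLim μ 0 + c₀ * c₁ * yLim μ 2 + c₁ * c₀ * yLim μ 2 + c₁ * c₁ * yLim μ 13 := by
  have h := wilsonLoop_integral_limit_gram_even hmono heven hμ (show (1 : Fin 4) ≠ 0 by decide) 2 (range 2)
    (fun a => if a = 0 then c₀ else c₁)
  rw [sum_range_two_two] at h
  norm_num at h
  rw [yLim_two' hμ, yLim_thirteen hμ, yLim_zero hμ, gLim_eq, gLim_eq,
    ← wilsonLoop_integral_limit_height_zero (by norm_num) hμ 1 2]
  linarith [h]

/-- `hankel-link/R1/S0-1`: the block `[[y₁, y₂], [y₂, y₅]]` (= `[g₁(a+b+1)]_{a,b<2}`) is positive semidefinite. [folklore] -/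
theorem limObj_hankelLink_R1 (c₀ c₁ : ℝ) :
    0 ≤ c₀ * c₀ * yLim μ 1 + c₀ * c₁ * yLim μ 2 + c₁ * c₀ * yLim μ 2 + c₁ * c₁ * yLim μ 5 := by
  have h := wilsonLoop_integral_limit_gram_odd hβ hmono heven hμ (show (1 : Fin 4) ≠ 0 by decide) 1 (range 2)
    (fun a => if a = 0 then c₀ else c₁)
  rw [sum_range_two_two] at h
  norm_num at h
  rw [yLim_one hμ, yLim_two hμ, yLim_five hμ, gLim_eq, gLim_eq, gLim_eq]
  linarith [h]

omit hβ in
/-- `hankel-site/R1/S0-2`: the `3 × 3` block `[g₁(a+b)]_{a,b<3}` on `(y₀, y₁, y₂, y₅, y₂₇)` is positive semidefinite (any real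
`β`). [folklore] -/
theorem limObj_hankelSite_R1 (c₀ c₁ c₂ : ℝ) :
    0 ≤ c₀ * c₀ * yLim μ 0 + c₀ * c₁ * yLim μ 1 + c₀ * c₂ * yLim μ 2 +
      (c₁ * c₀ * yLim μ 1 + c₁ * c₁ * yLim μ 2 + c₁ * c₂ * yLim μ 5) +
      (c₂ * c₀ * yLim μ 2 + c₂ * c₁ * yLim μ 5 + c₂ * c₂ * yLim μ 27) := by
  have h := wilsonLoop_integral_limit_gram_even hmono heven hμ (show (1 : Fin 4) ≠ 0 by decide) 1 (range 3)
    (fun a => if a = 0 then c₀ else if a = 1 then c₁ else c₂)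
  rw [sum_range_three_three] at h
  norm_num at h
  rw [yLim_zero_eq_gLim hμ, yLim_one hμ, yLim_two hμ, yLim_five hμ, yLim_twentyseven hμ, gLim_eq, gLim_eq, gLim_eq, gLim_eq,
    gLim_eq]
  linarith [h]

/-- `hd/R1/mono t=1` (uncapped files): `f₁(2) − f₁(1) ≤ 0`, i.e. `y₂ ≤ y₁` (antitone height profile at LIMIT points). [folklore] -/
theorem limObj_mono_R1_t1 : yLim μ 2 ≤ yLim μ 1 := by
  rw [yLim_one hμ, yLim_two hμ]
  exact (antitone_wilsonLoop_integral_limit hβ hmono heven hμ (show (1 : Fin 4) ≠ 0 by decide) 1).1 (Nat.le_succ 1)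

/-- `hd/R1/mono t=2`: `y₅ ≤ y₂`. [folklore] -/
theorem limObj_mono_R1_t2 : yLim μ 5 ≤ yLim μ 2 := by
  rw [yLim_two hμ, yLim_five hμ]
  exact (antitone_wilsonLoop_integral_limit hβ hmono heven hμ (show (1 : Fin 4) ≠ 0 by decide) 1).1 (Nat.le_succ 2)

/-- `hd/R1/mono t=3`: `y₂₇ ≤ y₅`. [folklore] -/
theorem limObj_mono_R1_t3 : yLim μ 27 ≤ yLim μ 5 := by
  rw [yLim_five hμ, yLim_twentyseven hμ]
  exact (antitone_wilsonLoop_integral_limit hβ hmono heven hμ (show (1 : Fin 4) ≠ 0 by decide) 1).1 (Nat.le_succ 3)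

/-- `hd/R2/mono t=1`: `f₂(2) − f₂(1) ≤ 0`, i.e. `y₁₃ ≤ y₂`. [folklore] -/
theorem limObj_mono_R2_t1 : yLim μ 13 ≤ yLim μ 2 := by
  rw [yLim_two' hμ, yLim_thirteen hμ]
  exact (antitone_wilsonLoop_integral_limit hβ hmono heven hμ (show (1 : Fin 4) ≠ 0 by decide) 2).1 (Nat.le_succ 1)


/-- `hd/R1/D0{0..1}` (uncapped files): the SITE difference-Hankel block with entries `(0,0) = y₀ − y₁`, `(0,1) = y₁ − y₂`,
`(1,1) = y₂ − y₅` is positive semidefinite (Lemma HD at the limit point, tree `Hankel.wilsonLoop_integral_limit_hankelDiff_site`). [folklore] -/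
theorem limObj_hankelDiff_D0 (c₀ c₁ : ℝ) :
    0 ≤ c₀ * c₀ * (yLim μ 0 - yLim μ 1) + c₀ * c₁ * (yLim μ 1 - yLim μ 2) + c₁ * c₀ * (yLim μ 1 - yLim μ 2) +
      c₁ * c₁ * (yLim μ 2 - yLim μ 5) := by
  have h := Hankel.wilsonLoop_integral_limit_hankelDiff_site hβ hmono heven hμ (show (1 : Fin 4) ≠ 0 by decide) 1 (range 2)
    (fun a => if a = 0 then c₀ else c₁)
  rw [sum_range_two_two] at h
  norm_num at h
  rw [yLim_zero_eq_gLim hμ, yLim_one hμ, yLim_two hμ, yLim_five hμ, gLim_eq, gLim_eq, gLim_eq, gLim_eq]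
  linarith [h]

/-- `hd/R1/D1{0..1}` (uncapped files): the LINK difference-Hankel block with entries `(0,0) = y₁ − y₂`, `(0,1) = y₂ − y₅`,
`(1,1) = y₅ − y₂₇` is positive semidefinite (tree `Hankel.wilsonLoop_integral_limit_hankelDiff_link`). [folklore] -/
theorem limObj_hankelDiff_D1 (c₀ c₁ : ℝ) :
    0 ≤ c₀ * c₀ * (yLim μ 1 - yLim μ 2) + c₀ * c₁ * (yLim μ 2 - yLim μ 5) + c₁ * c₀ * (yLim μ 2 - yLim μ 5) +
      c₁ * c₁ * (yLim μ 5 - yLim μ 27) := by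
  have h := Hankel.wilsonLoop_integral_limit_hankelDiff_link hβ hmono heven hμ (show (1 : Fin 4) ≠ 0 by decide) 1 (range 2)
    (fun a => if a = 0 then c₀ else c₁)
  rw [sum_range_two_two] at h
  norm_num at h
  rw [yLim_one hμ, yLim_two hμ, yLim_five hμ, yLim_twentyseven hμ, gLim_eq, gLim_eq, gLim_eq, gLim_eq]
  linarith [h]

end Objects

end Summit.QuantumFields.YangMills.Theorems.Instrument

end
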